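import Summits.CriticalPhenomena.CardyFormulaZ2.Theorems.CardyComplexConeParafermionToSLESixFamiliesIicDefs
import Literature.Probability.LatticeModels.MedialInterfaceProofs
import Literature.Probability.LatticeModels.MedialInterfaceMeasurability
import Literature.Probability.Percolation.PercolationProofs
import HarnessLib

/-!
# Junk audit of the touch vocabulary of line `iic-trace-flux-pairing` (stub S5 `stub_touchLawOfPairing`)

Crux `ParafermionToSLESixFamilies` (stmt-CriticalPhenomena-11389), line `iic-trace-flux-pairing`, definitions
module `Theorems/CardyComplexConeParafermionToSLESixFamiliesIicDefs.lean` (`touchSites`, `touchProb`,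
`touchFunctional`, `IsAxisDir`, `nCoord`, `tCoord`, `IsFlatFreeWindow`, `HasTouchDensityAt`, `TouchLawPos`,
`IsFamily`). The conclusion `TouchLawPos D` of S5 is built from a `∑ᶠ` (junk `0` on infinite support), a limit
`Tendsto … (𝓝[D.carrier] y)` (junk if the filter is `⊥`) and a density `ρ` quantified over ALL chordal
uniformizers. This file certifies, sorry-free, that none of these is junk in the regime of the stub:

* `touchSites_finite`, `touchSites_finite_of_isFamily`: for a bounded carrier and positive mesh (in particular
  along every family of a Dobrushin domain at every mesh `δ > 0`) the touch sites are finitely many, and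
  `touchFunctional_eq_sum`: the renormalised touch intensity is the genuine finite sum
  `δ^{2/3} ∑_{x ∈ touchSites} P(x ↔ A) g(δx)`; `touchFunctional_nonneg`, `abs_touchFunctional_le`.
* `touchProb_nonneg`, `touchProb_le_one`, `measurableSet_touchEvent` (a countable union of the tree's
  measurable two-point events pulled back along the measurable completion `bcBondConfig`),
  `isUpperSet_touchEvent` (the touch event `{x ↔ A}` is INCREASING — the input of the FKG gluing of step (vi)).
* `mem_touchSites_iff`: a touch site carries a touch corner `(x, f)` (inner face with a corner on `B`) — the
  corners at which `Theorems/…IicTouchPassage.lean` identifies passage with `x ↔ A` (DC12 Prop. 5).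
* Window bookkeeping: `norm_eq_one_of_isAxisDir`, `tCoord_windowPoint`, `nCoord_windowPoint` (the limit measure
  of `TouchLawPos` is carried by the window's boundary segment `t ↦ m + t·(iη)`, `|t| < a`),
  `windowPoint_not_mem_carrier`, `windowPoint_mem_arc`, `windowPoint_mem_closure_carrier` (so
  `𝓝[D.carrier] y ≠ ⊥` at window points: `nhdsWithin_carrier_neBot_of_window`), whence
  `HasTouchDensityAt.unique`: given one chordal uniformizer, the covariant density `ρ(y)` at a window point
  is UNIQUELY determined — `HasTouchDensityAt` is a definite, non-vacuous constraint.

Verdict of the audit (numbers, not adjectives): no junk found; masses `δ^{2/3}·#{touch sites in window}·P(x↔A)`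
are `O(1)` exactly when `β₁⁺ = 1/3` (S2 gives the lower half, S1 via the pairing the upper half).
-/

noncomputable section

open scoped Topology BigOperators
open Filter MeasureTheory Set Metric
open Literature.Probability.LatticeModels Literature.Probability.Percolation
open Literature.Probability.RandomPlanarGeometry

namespace Summit.CriticalPhenomena.CardyFormulaZ2.Cruxes.ParafermionToSLESixFamilies.IicTraceFluxPairing

/-! ### Touch sites are finitely many; the touch functional is a finite sum -/

section Finiteness

variable (E : DiscreteDobrushin)

/-- A touch site, unfolded: off both arcs, a corner of an inner face having a corner on the arc `B`. -/
theorem mem_touchSites_iff {x : Site 2} :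
    x ∈ touchSites E ↔ x ∉ E.zdArcA ∧ x ∉ E.zdArcB ∧
      ∃ f : Site 2, E.IsInnerFace f ∧ IsCorner x f ∧ ∃ u : Site 2, IsCorner u f ∧ u ∈ E.zdArcB :=
  Iff.rfl

/-- Touch sites are corners of inner faces. -/
theorem touchSites_subset_innerCorners :
    touchSites E ⊆ {x | ∃ f : Site 2, E.IsInnerFace f ∧ IsCorner x f} := by
  rintro x ⟨-, -, f, hf, hxf, -⟩
  exact ⟨f, hf, hxf⟩

variable {E}

/-- For a bounded carrier and a positive mesh, the corners of inner faces form a finite set (finitely many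
inner faces, four corners each). -/
theorem finite_innerCorners (hΩ : Bornology.IsBounded E.Ω) (hδ : 0 < E.δ) :
    {x : Site 2 | ∃ f : Site 2, E.IsInnerFace f ∧ IsCorner x f}.Finite := by
  have hF : {f : Site 2 | E.IsInnerFace f}.Finite := by
    have h := finite_hasAllSides (D := E) hΩ hδ
    refine h.subset fun f hf => ?_
    exact (isInnerFace_iff_hasAllSides (D := E) f).1 hf
  refine ((hF.prod (Set.finite_univ (α := Fin 4))).image fun p : Site 2 × Fin 4 => p.1 + cornerOff p.2).subset ?_
  rintro x ⟨f, hf, hxf⟩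
  obtain ⟨k, hk⟩ := exists_faceAt_of_isCorner hxf
  refine ⟨(f, k), ⟨hf, Set.mem_univ _⟩, ?_⟩
  simp only [hk, faceAt, sub_add_cancel]

/-- **Registered glue `touchSites_finite` — touch sites are finitely many** for a bounded carrier and a
positive mesh (so the `∑ᶠ` of `touchFunctional` is never the junk value). -/
theorem touchSites_finite : ∀ (E : DiscreteDobrushin), Bornology.IsBounded E.Ω → 0 < E.δ → (touchSites E).Finite := by
  intro E hΩ hδ
  exact (finite_innerCorners hΩ hδ).subset (touchSites_subset_innerCorners E)

/-- Along a family of a Dobrushin domain, at every positive mesh the touch sites are finitely many (the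
carrier `D` is bounded, the mesh is `δ`). -/
theorem touchSites_finite_of_isFamily {D : DobrushinDomain} {Λ : ℝ → DiscreteDobrushin} (hΛ : IsFamily D Λ)
    {δ : ℝ} (hδ : 0 < δ) : (touchSites (Λ δ)).Finite :=
  touchSites_finite _ (by rw [hΛ.1 δ]; exact D.isBounded) (by rw [hΛ.2.1 δ]; exact hδ)

/-- **The touch functional is a genuine finite sum** (no `∑ᶠ` junk): for a bounded carrier and positive mesh,
`touchFunctional E g = δ^{2/3} · ∑_{x ∈ touchSites E} P(x ↔ A) · g(δx)`. -/
theorem touchFunctional_eq_sum (hΩ : Bornology.IsBounded E.Ω) (hδ : 0 < E.δ) (g : ℂ → ℝ) :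
    touchFunctional E g =
      E.δ ^ ((2:ℝ) / 3) * ∑ x ∈ (touchSites_finite E hΩ hδ).toFinset, touchProb E x * g (meshPoint E.δ x) := by
  unfold touchFunctional
  congr 1
  rw [finsum_eq_sum_of_support_subset _ (s := (touchSites_finite E hΩ hδ).toFinset)]
  · refine Finset.sum_congr rfl fun x hx => ?_
    rw [Set.indicator_of_mem ((Set.Finite.mem_toFinset _).1 hx)]
  · intro x hx
    rw [Function.mem_support] at hx
    rw [Finset.mem_coe, Set.Finite.mem_toFinset]
    by_contra h
    exact hx (Set.indicator_of_notMem h _)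

end Finiteness

/-! ### The touch probability: a genuine probability of a measurable increasing event -/

section TouchProb

variable (E : DiscreteDobrushin) (x : Site 2)

/-- `0 ≤ touchProb E x`. -/
theorem touchProb_nonneg : 0 ≤ touchProb E x := measureReal_nonneg

/-- `touchProb E x ≤ 1`. -/
theorem touchProb_le_one : touchProb E x ≤ 1 := by
  unfold touchProb
  exact measureReal_le_one

/-- The completion by the boundary condition is a measurable map of configurations. -/
theorem measurable_bcBondConfig : Measurable E.bcBondConfig :=
  measurable_set_iff.2 fun e => measurable_mem_bcBondConfig E e

/-- **The touch event `{x ↔ A}` is measurable**: a countable union over `y ∈ A` of the two-point events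
`{x ↔ y}` (measurable, `measurableSet_openConn_holds`) pulled back along `bcBondConfig`. -/
theorem measurableSet_touchEvent :
    MeasurableSet {ω : BondConfig (Site 2) | ∃ y ∈ E.zdArcA, (openGraph (E.bcBondConfig ω)).Reachable x y} := by
  have h : {ω : BondConfig (Site 2) | ∃ y ∈ E.zdArcA, (openGraph (E.bcBondConfig ω)).Reachable x y} =
      ⋃ y ∈ E.zdArcA, E.bcBondConfig ⁻¹' (openConn x y) := by
    ext ω
    simp [openConn]
  rw [h]
  exact MeasurableSet.biUnion (Set.to_countable _) fun y _ =>
    measurable_bcBondConfig E (measurableSet_openConn_holds x y)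

/-- **The touch event is increasing** (opening edges of `ω` only opens edges of the completed configuration):
the monotonicity behind the FKG/RSW gluing of step (vi) of S5. -/
theorem isUpperSet_touchEvent :
    IsUpperSet {ω : BondConfig (Site 2) | ∃ y ∈ E.zdArcA, (openGraph (E.bcBondConfig ω)).Reachable x y} := by
  intro ω ω' hle hω
  obtain ⟨y, hy, hreach⟩ := hω
  refine ⟨y, hy, hreach.mono ?_⟩
  exact SimpleGraph.fromEdgeSet_mono (E.bcBondConfig_mono hle)

/-- `touchProb` as the measure of the (measurable) touch event, in `ℝ≥0∞` form. -/
theorem touchProb_eq_toReal :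
    touchProb E x = ((bondPercolation (zdGraph 2) half)
      {ω | ∃ y ∈ E.zdArcA, (openGraph (E.bcBondConfig ω)).Reachable x y}).toReal := rfl

end TouchProb

/-! ### Sign and size of the touch functional -/

section Size

variable {E : DiscreteDobrushin}

/-- For a non-negative test function and a non-negative mesh the touch functional is non-negative. -/
theorem touchFunctional_nonneg (hδ : 0 ≤ E.δ) {g : ℂ → ℝ} (hg : ∀ z, 0 ≤ g z) : 0 ≤ touchFunctional E g := by
  unfold touchFunctional
  refine mul_nonneg (Real.rpow_nonneg hδ _) (finsum_nonneg fun x => ?_)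
  refine Set.indicator_nonneg (fun y _ => ?_) x
  exact mul_nonneg (touchProb_nonneg E y) (hg _)

/-- Crude size bound: `|touchFunctional E g| ≤ δ^{2/3} · #(touchSites E) · M` whenever `|g| ≤ M`
(finitely many touch sites, touch probabilities in `[0, 1]`). -/
theorem abs_touchFunctional_le (hΩ : Bornology.IsBounded E.Ω) (hδ : 0 < E.δ) {g : ℂ → ℝ} {M : ℝ}
    (hg : ∀ z, |g z| ≤ M) :
    |touchFunctional E g| ≤ E.δ ^ ((2:ℝ) / 3) * ((touchSites_finite E hΩ hδ).toFinset.card * M) := by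
  rw [touchFunctional_eq_sum hΩ hδ, abs_mul, abs_of_nonneg (Real.rpow_nonneg hδ.le _)]
  refine mul_le_mul_of_nonneg_left ?_ (Real.rpow_nonneg hδ.le _)
  refine (Finset.abs_sum_le_sum_abs _ _).trans ?_
  have hterm : ∀ x ∈ (touchSites_finite E hΩ hδ).toFinset, |touchProb E x * g (meshPoint E.δ x)| ≤ M := by
    intro x _
    rw [abs_mul, abs_of_nonneg (touchProb_nonneg E x)]
    calc touchProb E x * |g (meshPoint E.δ x)| ≤ 1 * |g (meshPoint E.δ x)| :=
          mul_le_mul_of_nonneg_right (touchProb_le_one E x) (abs_nonneg _)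
      _ ≤ M := by rw [one_mul]; exact hg _
  calc ∑ x ∈ (touchSites_finite E hΩ hδ).toFinset, |touchProb E x * g (meshPoint E.δ x)|
      ≤ ∑ _x ∈ (touchSites_finite E hΩ hδ).toFinset, M := Finset.sum_le_sum hterm
    _ = (touchSites_finite E hΩ hδ).toFinset.card * M := by rw [Finset.sum_const, nsmul_eq_mul]

end Size

/-! ### Window bookkeeping: where the limit measure of `TouchLawPos` lives -/

section Window

/-- Axis directions are unit vectors. -/
theorem norm_eq_one_of_isAxisDir {η : ℂ} (hη : IsAxisDir η) : ‖η‖ = 1 := by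
  rcases hη with rfl | rfl | rfl | rfl <;> simp

/-- For a unit direction, `η · conj η = 1`. -/
theorem mul_conj_eq_one_of_isAxisDir {η : ℂ} (hη : IsAxisDir η) : η * (starRingEnd ℂ) η = 1 := by
  rw [Complex.mul_conj, Complex.normSq_eq_norm_sq, norm_eq_one_of_isAxisDir hη]
  simp

/-- The window's boundary parametrisation `t ↦ m + t·(iη)` has tangential coordinate `t`. -/
theorem tCoord_windowPoint {η : ℂ} (hη : IsAxisDir η) (m : ℂ) (t : ℝ) :
    tCoord m η (m + (t : ℂ) * (Complex.I * η)) = t := by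
  unfold tCoord
  have h : (m + (t : ℂ) * (Complex.I * η) - m) * (starRingEnd ℂ) (Complex.I * η) = (t : ℂ) := by
    rw [add_sub_cancel_left, map_mul, Complex.conj_I]
    calc (t : ℂ) * (Complex.I * η) * (-Complex.I * (starRingEnd ℂ) η)
        = (t : ℂ) * (η * (starRingEnd ℂ) η) * (Complex.I * -Complex.I) := by ring
      _ = (t : ℂ) := by rw [mul_conj_eq_one_of_isAxisDir hη]; simp
  rw [h, Complex.ofReal_re]

/-- The window's boundary parametrisation has normal coordinate `0`. -/
theorem nCoord_windowPoint {η : ℂ} (hη : IsAxisDir η) (m : ℂ) (t : ℝ) :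
    nCoord m η (m + (t : ℂ) * (Complex.I * η)) = 0 := by
  unfold nCoord
  have h : (m + (t : ℂ) * (Complex.I * η) - m) * (starRingEnd ℂ) η = (t : ℂ) * Complex.I := by
    rw [add_sub_cancel_left]
    calc (t : ℂ) * (Complex.I * η) * (starRingEnd ℂ) η = (t : ℂ) * Complex.I * (η * (starRingEnd ℂ) η) := by ring
      _ = (t : ℂ) * Complex.I := by rw [mul_conj_eq_one_of_isAxisDir hη, mul_one]
  rw [h]
  simp

/-- Moving from the window point `m + t·(iη)` by `s·η` along the inward normal: tangential coordinate `t`,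
normal coordinate `s`. -/
theorem coords_windowPoint_add {η : ℂ} (hη : IsAxisDir η) (m : ℂ) (t s : ℝ) :
    tCoord m η (m + (t : ℂ) * (Complex.I * η) + (s : ℂ) * η) = t ∧
      nCoord m η (m + (t : ℂ) * (Complex.I * η) + (s : ℂ) * η) = s := by
  have hu := mul_conj_eq_one_of_isAxisDir hη
  constructor
  · unfold tCoord
    have h : (m + (t : ℂ) * (Complex.I * η) + (s : ℂ) * η - m) * (starRingEnd ℂ) (Complex.I * η) =
        (t : ℂ) - (s : ℂ) * Complex.I := by
      rw [map_mul, Complex.conj_I]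
      calc (m + (t : ℂ) * (Complex.I * η) + (s : ℂ) * η - m) * (-Complex.I * (starRingEnd ℂ) η)
          = ((t : ℂ) * (Complex.I * -Complex.I) - (s : ℂ) * Complex.I) * (η * (starRingEnd ℂ) η) := by ring
        _ = (t : ℂ) - (s : ℂ) * Complex.I := by rw [hu]; simp
    rw [h]
    simp
  · unfold nCoord
    have h : (m + (t : ℂ) * (Complex.I * η) + (s : ℂ) * η - m) * (starRingEnd ℂ) η =
        (t : ℂ) * Complex.I + (s : ℂ) := by
      calc (m + (t : ℂ) * (Complex.I * η) + (s : ℂ) * η - m) * (starRingEnd ℂ) η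
          = ((t : ℂ) * Complex.I + (s : ℂ)) * (η * (starRingEnd ℂ) η) := by ring
        _ = (t : ℂ) * Complex.I + (s : ℂ) := by rw [hu, mul_one]
    rw [h]
    simp

variable {D : DobrushinDomain} {m η : ℂ} {a b : ℝ}

/-- Window points are boundary points: NOT in the (open) carrier. -/
theorem windowPoint_not_mem_carrier (hW : IsFlatFreeWindow D m η a b) {t : ℝ} (ht : |t| < a) :
    m + (t : ℂ) * (Complex.I * η) ∉ D.carrier := by
  intro hmem
  have h1 := tCoord_windowPoint hW.axis m t
  have h2 := nCoord_windowPoint hW.axis m t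
  have := (hW.carrier_iff (m + (t : ℂ) * (Complex.I * η)) (by rw [h1]; exact ht)
    (by rw [h2, abs_zero]; exact hW.b_pos)).1 hmem
  rw [h2] at this
  exact lt_irrefl _ this

/-- Window points lie on the free arc `D.arc 1`. -/
theorem windowPoint_mem_arc (hW : IsFlatFreeWindow D m η a b) {t : ℝ} (ht : |t| < a) :
    m + (t : ℂ) * (Complex.I * η) ∈ D.arc 1 :=
  hW.subset_arc _ (by rw [tCoord_windowPoint hW.axis]; exact ht) (nCoord_windowPoint hW.axis m t)

/-- Window points are not the marked points. -/
theorem windowPoint_ne_marks (hW : IsFlatFreeWindow D m η a b) {t : ℝ} (ht : |t| < a) :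
    m + (t : ℂ) * (Complex.I * η) ≠ D.pt 0 ∧ m + (t : ℂ) * (Complex.I * η) ≠ D.pt 1 :=
  hW.marks _ (by rw [tCoord_windowPoint hW.axis]; exact ht)
    (by rw [nCoord_windowPoint hW.axis, abs_zero]; exact hW.b_pos)

/-- Points just inside the window (normal coordinate `s ∈ (0, b)`) belong to the carrier. -/
theorem windowPoint_add_mem_carrier (hW : IsFlatFreeWindow D m η a b) {t s : ℝ} (ht : |t| < a)
    (hs : 0 < s) (hsb : s < b) : m + (t : ℂ) * (Complex.I * η) + (s : ℂ) * η ∈ D.carrier := by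
  obtain ⟨h1, h2⟩ := coords_windowPoint_add hW.axis m t s
  refine (hW.carrier_iff _ (by rw [h1]; exact ht) (by rw [h2, abs_of_pos hs]; exact hsb)).2 ?_
  rw [h2]; exact hs

/-- **Window points lie in the closure of the carrier** (approach along the inward normal). -/
theorem windowPoint_mem_closure_carrier (hW : IsFlatFreeWindow D m η a b) {t : ℝ} (ht : |t| < a) :
    m + (t : ℂ) * (Complex.I * η) ∈ closure D.carrier := by
  rw [Metric.mem_closure_iff]
  intro ε hε
  set s := min (ε / 2) (b / 2) with hs
  have hs0 : 0 < s := lt_min (half_pos hε) (half_pos hW.b_pos)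
  have hsb : s < b := (min_le_right _ _).trans_lt (half_lt_self hW.b_pos)
  refine ⟨m + (t : ℂ) * (Complex.I * η) + (s : ℂ) * η, windowPoint_add_mem_carrier hW ht hs0 hsb, ?_⟩
  rw [dist_eq_norm]
  have : m + (t : ℂ) * (Complex.I * η) - (m + (t : ℂ) * (Complex.I * η) + (s : ℂ) * η) = -((s : ℂ) * η) := by ring
  rw [this, norm_neg, norm_mul, norm_eq_one_of_isAxisDir hW.axis, mul_one, Complex.norm_real, Real.norm_eq_abs,
    abs_of_pos hs0]
  exact (min_le_left _ _).trans_lt (half_lt_self hε)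

/-- Hence `𝓝[D.carrier] y` is non-trivial at every window point `y`: the limit in `HasTouchDensityAt` is a
genuine constraint, not a `Tendsto` along `⊥`. -/
theorem nhdsWithin_carrier_neBot_of_window (hW : IsFlatFreeWindow D m η a b) {t : ℝ} (ht : |t| < a) :
    (𝓝[D.carrier] (m + (t : ℂ) * (Complex.I * η))).NeBot :=
  mem_closure_iff_nhdsWithin_neBot.1 (windowPoint_mem_closure_carrier hW ht)

/-- **The covariant touch density at a window point is uniquely determined** (given a chordal uniformizer
`φ`): two values `ρ, ρ'` both satisfying `HasTouchDensityAt D y ·` coincide. -/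
theorem HasTouchDensityAt.unique (hW : IsFlatFreeWindow D m η a b) {t : ℝ} (ht : |t| < a)
    (φ : ConformalEquiv UpperHalfPlane.upperHalfPlaneSet D.carrier) (hφ : D.IsChordalUniformizing φ) {ρ ρ' : ℝ}
    (h : HasTouchDensityAt D (m + (t : ℂ) * (Complex.I * η)) ρ)
    (h' : HasTouchDensityAt D (m + (t : ℂ) * (Complex.I * η)) ρ') : ρ = ρ' := by
  haveI := nhdsWithin_carrier_neBot_of_window hW ht
  exact tendsto_nhds_unique (h φ hφ) (h' φ hφ)

/-- Consequently the density FUNCTION of `TouchLawPos` is unique on the window: two admissible choices agree at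
every window point (so the limit `c · ρ · dt` is determined up to the constant `c`). -/
theorem touchDensity_eqOn_window (hW : IsFlatFreeWindow D m η a b)
    (φ : ConformalEquiv UpperHalfPlane.upperHalfPlaneSet D.carrier) (hφ : D.IsChordalUniformizing φ) {ρ ρ' : ℂ → ℝ}
    (h : ∀ y : ℂ, |tCoord m η y| < a → nCoord m η y = 0 → HasTouchDensityAt D y (ρ y))
    (h' : ∀ y : ℂ, |tCoord m η y| < a → nCoord m η y = 0 → HasTouchDensityAt D y (ρ' y)) :
    ∀ t : ℝ, |t| < a → ρ (m + (t : ℂ) * (Complex.I * η)) = ρ' (m + (t : ℂ) * (Complex.I * η)) := by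
  intro t ht
  have h1 := tCoord_windowPoint hW.axis m t
  have h2 := nCoord_windowPoint hW.axis m t
  exact HasTouchDensityAt.unique hW ht φ hφ (h _ (by rw [h1]; exact ht) h2) (h' _ (by rw [h1]; exact ht) h2)

end Window

end Summit.CriticalPhenomena.CardyFormulaZ2.Cruxes.ParafermionToSLESixFamilies.IicTraceFluxPairing

end
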